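import Mathlib.NumberTheory.NumberField.Completion.InfinitePlace
import Mathlib.NumberTheory.NumberField.Completion.FinitePlace
import Literature.IUT.HodgeTheaters.KappaCoricRatGaloisLocalKit
import Literature.IUT.HodgeTheaters.PlaceKitBridge
import HarnessLib

/-!
# [IUTchI] Definition 5.2 (v)/(vii): the local `∞κ`-coric layer AT THE PLACES `v ∈ 𝕍` — completions `K_v`
# (nonarchimedean `adicCompletion`, archimedean `InfinitePlace.Completion`), units `U := 𝒪^×_{K_v}`, and the
# bundled layer at `v̲ ∈ V̲` of an initial Θ-datum (GAP B = G-L5t9g8-1, item GB-02 = GAP-SIZING-B.md row D2, 3/3)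

S. Mochizuki, *Inter-universal Teichmüller theory I*, kurims manuscript (May 2020), Definition 5.2 (v) p. 135
(«`v ∈ 𝕍^non` … the scheme obtained by base-changing to `(F_mod)_v` the generic point of `C_{F_mod}` … pseudo-monoids
of κ-, `∞κ`-, and `∞κ×`-coric rational functions associated to `C_v`»), (vii) p. 139 (archimedean `v`), Remark
3.1.7 (i), (ii) pp. 66–67 («`L` … a completion `(F_mod)_v`», «`U_L = 𝒪^×_L` if `L = (F_mod)_v`»), Definition 3.1 (e)
p. 62 (`V̲ ⊆ V(K)`, `V̲ ⥲ V_mod`) ([IUTchI] Def 5.2 (v) p.135) [claim: Mochizuki2012, status: disputed] (D-0012 claim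
key, series status DISPUTED — definitions at OUR model presentation; nothing of the series is asserted; no side
is taken on [IUTchIII] Cor. 3.12).

## What is built (row D2: «L_v := completion of K at v (nonarch `IsDedekindDomain.HeightOneSpectrum.adicCompletion`,
## arch via `NumberField.InfinitePlace`), t4-shape kit … (U := units)»; R3 pin of abc-iut-inv-2 SERVED-2: the index
## type at the stub of record is `D.IndexCopy ≃ V̲`, nonarch completion = Mathlib `adicCompletion` as in abc-iut-S7's
## `RescaledCompletion`, arch = Mathlib `InfinitePlace.Completion`)

For a number field `K` and a valuation `w : Val K` (§0 `Val K = InfinitePlace K ⊕ FinitePlace K`):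
* `CriticalLocus.baseChange S φ` — an `L`-rational critical locus read in an extension `φ : L →+* L'` (here
  `K → K_w`; the strictly critical points are `F`-rational, Def 3.1 (b), so a `K`-rational `S : CriticalLocus K`
  is the honest input — a PARAMETER here, GAP-SIZING-B.md R4);
* nonarchimedean `w`: `K_w := w.maximalIdeal.adicCompletion K` (Mathlib; characteristic `0` PROVED, not an
  instance), `U := 𝒪^×_{K_w} = {c | v(c) = 1}` (`nonarchUnits`), and the bundled layer
  `localInfKappaLayerNonarch K S w := LocalInfKappaLayer.ofField K_w (S.baseChange _) U`;
* archimedean `w`: `K_w := w.Completion` (Mathlib), `U := {c | ‖c‖ = 1}` (`archUnits`, print's `𝒪^× ≅ 𝕊¹`,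
  Def 5.2 (vii) p. 139 «isomorphic … to `𝕊¹`»), `localInfKappaLayerArch` — HONEST LABEL: at archimedean `v`
  print's `π₁^{rat}(‡𝒟_v)` is Aut-holomorphic (deck transformations of `‡𝒟^{rat}_v → ‡𝒟̄_v`, Def 5.2 (vii));
  the Galois group `Gal(Λ_{K_w}/K_w(t))` used here is a MODEL label only (GAP-SIZING-B.md R3; the same
  «A3-INTERFACE» convention as abc-iut-L5-lead RULINGS #57 (3) for archimedean `𝒟_v`);
* `Val.localInfKappaLayer K S w` — UNIFORM in `w : Val K` (by cases on the sum), so that a consumer indexed by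
  places needs no case analysis; `InitialThetaData.localInfKappaLayerAt D S x` — the layer at `v̲ = indexCopyVal x`,
  `x : D.IndexCopy` (the index type of the stub of record `D.s5LocalThetaOfBadPairs …`, abc-iut-w5's
  `PlaceKitBridge.lean`), i.e. at the completion `K_v̲` (row D2 «completion of K at v»); and
  `InitialThetaData.localInfKappaLayerMod D S' x` — the same construction for the number field `F_mod` at
  `v = toVMod v̲ ∈ V_mod` (print's base field «`(F_mod)_v`», Def 5.2 (v) p. 135 l. 42; Rmk 3.1.7 (i)), offered
  side by side since the construction is uniform in the number field.

Definitions + two characteristic-zero lemmas; no instance, no notation, no axiom, no `sorry`.  MODEL presentation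
(RULINGS #316 (i)); typed/built ≠ proved-in-print; count-neutral until the chair tokens the row; nothing here
asserts that abc is proved or refuted.
-/

noncomputable section

namespace Literature.IUT.HodgeTheaters

open _root_.NumberField _root_.IsDedekindDomain

universe u v w

/-! ### Transport of an `L`-rational critical locus along a field extension -/

namespace CriticalLocus

/-- An `L`-rational strictly critical locus read in an extension `φ : L → L'` of fields (`φ` is injective, so
the three points stay distinct) — e.g. `K → K_v` (the critical points are `F`-rational, Def 3.1 (b)).
([IUTchI] Rmk 3.1.7 (i) p.66) [claim: Mochizuki2012, status: disputed] -/
def baseChange {L : Type u} {L' : Type v} [Field L] [Field L'] (S : CriticalLocus L) (φ : L →+* L') :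
    CriticalLocus L' :=
  ⟨S.pts.map ⟨φ, φ.injective⟩, by rw [Finset.card_map]; exact S.card_eq⟩

/-- The points of `S.baseChange φ` are the `φ`-images of the points of `S`. ([IUTchI] Rmk 3.1.7 (i) p.66)
[claim: Mochizuki2012, status: disputed] -/
theorem mem_baseChange_pts_iff {L : Type u} {L' : Type v} [Field L] [Field L'] (S : CriticalLocus L)
    (φ : L →+* L') (e : L') : e ∈ (S.baseChange φ).pts ↔ ∃ a ∈ S.pts, φ a = e := by
  simp [baseChange]

end CriticalLocus

/-! ### The completions `K_w` and their units -/

section Completions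

variable (K : Type v) [Field K] [NumberField K]

/-- The nonarchimedean completion `K_w` (Mathlib `adicCompletion` at the maximal ideal of the finite place `w`,
the apparatus of abc-iut-S7's `RescaledCompletion`) has characteristic `0` — a lemma, NOT an instance (it
contains `K`). ([IUTchI] Def 5.2 (v) p.135) [claim: Mochizuki2012, status: disputed] -/
theorem charZero_adicCompletion (w : FinitePlace K) : CharZero (w.maximalIdeal.adicCompletion K) :=
  charZero_of_injective_algebraMap (algebraMap K (w.maximalIdeal.adicCompletion K)).injective

/-- The archimedean completion `K_w` (Mathlib `InfinitePlace.Completion`, `≅ ℝ` or `ℂ`) has characteristic `0` —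
a lemma, NOT an instance. ([IUTchI] Def 5.2 (vii) p.139) [claim: Mochizuki2012, status: disputed] -/
theorem charZero_infinitePlaceCompletion (w : InfinitePlace K) : CharZero w.Completion :=
  charZero_of_injective_algebraMap (algebraMap K w.Completion).injective

/-- `U := 𝒪^×_{K_w} ⊆ K_w` at a nonarchimedean `w`: the elements of valuation `1` («`U_L =` the units of `L` if
`L = (F_mod)_v`», Rmk 3.1.7 (ii) p. 67). ([IUTchI] Rmk 3.1.7 (ii) p.67) [claim: Mochizuki2012, status: disputed] -/
def nonarchUnits (w : FinitePlace K) : Set (w.maximalIdeal.adicCompletion K) := {c | Valued.v c = 1}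

/-- `U ⊆ K_w` at an archimedean `w`: the elements of absolute value `1` (`𝒪^×_{K_w} ≅ 𝕊¹`, Def 5.2 (vii) p. 139
«isomorphic, as abstract topological monoids, to `𝕊¹`»). ([IUTchI] Def 5.2 (vii) p.139) [claim: Mochizuki2012, status: disputed] -/
def archUnits (w : InfinitePlace K) : Set w.Completion := {c | ‖c‖ = 1}

/-- `1 ∈ 𝒪^×_{K_w}` (so `𝕄_{∞κv} ⊆ 𝕄_{∞κ×v}`, `CriticalLocus.minfkSet_subset_minfkxSet`).
([IUTchI] Rmk 3.1.7 (ii) p.67) [claim: Mochizuki2012, status: disputed] -/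
theorem one_mem_nonarchUnits (w : FinitePlace K) : (1 : w.maximalIdeal.adicCompletion K) ∈ nonarchUnits K w :=
  map_one _

omit [NumberField K] in
/-- `1 ∈ U` at an archimedean place. ([IUTchI] Def 5.2 (vii) p.139) [claim: Mochizuki2012, status: disputed] -/
theorem one_mem_archUnits (w : InfinitePlace K) : (1 : w.Completion) ∈ archUnits K w :=
  norm_one

/-! ### The bundled local layer at a place -/

/-- **The local `∞κ`-coric layer at a nonarchimedean `w`**: `π₁^{rat} := Gal(Λ_{K_w}/K_w(t))` and the t4-shape kit
`CriticalLocus.infKappaCoricKit (S.baseChange (K → K_w)) 𝒪^×_{K_w}` (divisors over `K̄_w ⊂ Λ_{K_w}`), bundled.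
([IUTchI] Def 5.2 (v) p.135) [claim: Mochizuki2012, status: disputed] -/
def localInfKappaLayerNonarch (S : CriticalLocus K) (w : FinitePlace K) : LocalInfKappaLayer.{v} :=
  haveI := charZero_adicCompletion K w
  LocalInfKappaLayer.ofField (w.maximalIdeal.adicCompletion K)
    (S.baseChange (algebraMap K (w.maximalIdeal.adicCompletion K))) (nonarchUnits K w)

/-- **The local `∞κ`-coric layer at an archimedean `w`** (MODEL label: print's archimedean `π₁^{rat}(‡𝒟_v)` is
Aut-holomorphic, Def 5.2 (vii); here `Gal(Λ_{K_w}/K_w(t))`, GAP-SIZING-B.md R3): the kit at `K_w ≅ ℝ, ℂ` with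
`U = {‖c‖ = 1}`, bundled. ([IUTchI] Def 5.2 (vii) p.139) [claim: Mochizuki2012, status: disputed] -/
def localInfKappaLayerArch (S : CriticalLocus K) (w : InfinitePlace K) : LocalInfKappaLayer.{v} :=
  haveI := charZero_infinitePlaceCompletion K w
  LocalInfKappaLayer.ofField w.Completion (S.baseChange (algebraMap K w.Completion)) (archUnits K w)

/-- **The local `∞κ`-coric layer at `w ∈ V(K)`, UNIFORM in the place** (`Val K = InfinitePlace K ⊕ FinitePlace K`,
§0): archimedean ↦ `localInfKappaLayerArch`, nonarchimedean ↦ `localInfKappaLayerNonarch`.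
([IUTchI] Def 5.2 (v) p.135) [claim: Mochizuki2012, status: disputed] -/
def Val.localInfKappaLayer (S : CriticalLocus K) (w : Val K) : LocalInfKappaLayer.{v} :=
  Sum.elim (localInfKappaLayerArch K S) (localInfKappaLayerNonarch K S) w

/-- At an archimedean valuation the uniform layer is the archimedean one. ([IUTchI] Def 5.2 (vii) p.139)
[claim: Mochizuki2012, status: disputed] -/
theorem Val.localInfKappaLayer_arc (S : CriticalLocus K) (w : InfinitePlace K) :
    Val.localInfKappaLayer K S (Val.arc w) = localInfKappaLayerArch K S w := rfl

/-- At a nonarchimedean valuation the uniform layer is the nonarchimedean one. ([IUTchI] Def 5.2 (v) p.135)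
[claim: Mochizuki2012, status: disputed] -/
theorem Val.localInfKappaLayer_non (S : CriticalLocus K) (w : FinitePlace K) :
    Val.localInfKappaLayer K S (Val.non w) = localInfKappaLayerNonarch K S w := rfl

/-- The group of the nonarchimedean layer is `Gal(Λ_{K_w}/K_w(t))` (GB-01's `RatGal K_w`).
([IUTchI] Def 5.2 (v) p.135) [claim: Mochizuki2012, status: disputed] -/
theorem localInfKappaLayerNonarch_rat (S : CriticalLocus K) (w : FinitePlace K) :
    (localInfKappaLayerNonarch K S w).rat = CriticalLocus.ratGalois (w.maximalIdeal.adicCompletion K) := rfl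

/-- The group of the archimedean layer is `Gal(Λ_{K_w}/K_w(t))` (MODEL label, see `localInfKappaLayerArch`).
([IUTchI] Def 5.2 (vii) p.139) [claim: Mochizuki2012, status: disputed] -/
theorem localInfKappaLayerArch_rat (S : CriticalLocus K) (w : InfinitePlace K) :
    (localInfKappaLayerArch K S w).rat = CriticalLocus.ratGalois w.Completion := rfl

end Completions

/-! ### At the places `v̲ ∈ V̲` of an initial Θ-datum -/

section AtInitialThetaData

variable {F : Type u} {K : Type v} {Fbar : Type w} [Field F] [NumberField F] [Field K] [NumberField K]
  [Algebra F K] [Field Fbar] [Algebra F Fbar] [Algebra K Fbar]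
  {E : WeierstrassCurve F} [E.IsElliptic] {l : ℕ} {Pb : BadPlacePredicates K}
  (D : InitialThetaData F K Fbar E l Pb)

namespace InitialThetaData

/-- **GAP-SIZING-B.md row D2 at the genuine datum — the local `∞κ`-coric layer at `v̲ ∈ V̲`**, indexed by the
index type `D.IndexCopy ≃ V̲` of the stub of record (`indexCopyVal x ∈ V̲ ⊆ V(K)`): the layer at the completion
`K_v̲` of `K` (row D2 «L_v := completion of K at v»), for a `K`-rational strictly critical locus `S` (the
x-coordinates of `E_F[2] ∖ {O}`, `F`-rational by Def 3.1 (b) — a parameter here, R4).  The fields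
`rat/ratGroup/ratTop/kit.infkx/kit.infk` are the `locRat/locRatGroup/locRatTop/locInfkx/locInfk` data of a
`S5Local.InfKappaLink` at `v̲` (uniform in `x`, no case analysis). ([IUTchI] Def 5.2 (v) p.135)
[claim: Mochizuki2012, status: disputed] -/
def localInfKappaLayerAt (S : CriticalLocus K) (x : D.IndexCopy) : LocalInfKappaLayer.{v} :=
  Val.localInfKappaLayer K S (D.indexCopyVal x)

/-- The same construction over print's base field «`(F_mod)_v`» (Def 5.2 (v) p. 135 l. 42, Rmk 3.1.7 (i): `L = (F_mod)_v`,
`v ∈ V_mod`): the layer of the number field `F_mod = fieldOfModuli E` at `v = toVMod v̲`, for an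
`F_mod`-rational critical locus `S'` (when the critical points are only `F`-rational, use `localInfKappaLayerAt`;
R4). ([IUTchI] Def 5.2 (v) p.135) [claim: Mochizuki2012, status: disputed] -/
def localInfKappaLayerMod (S' : CriticalLocus (fieldOfModuli E)) (x : D.IndexCopy) : LocalInfKappaLayer.{u} :=
  Val.localInfKappaLayer (fieldOfModuli E) S' (toVMod F K E (D.indexCopyVal x))

/-- Unfolding `localInfKappaLayerAt`. ([IUTchI] Def 5.2 (v) p.135) [claim: Mochizuki2012, status: disputed] -/
theorem localInfKappaLayerAt_eq (S : CriticalLocus K) (x : D.IndexCopy) :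
    D.localInfKappaLayerAt S x = Val.localInfKappaLayer K S (D.indexCopyVal x) := rfl

end InitialThetaData

end AtInitialThetaData

end Literature.IUT.HodgeTheaters

end
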